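import Summits.Ventures.PercRepro.GenQFlatLatticeA
import Summits.Ventures.PercRepro.GenQFlatLatticeT

/-!
# PercRepro — the rank-6 block of the `(10, 8)` profile LP: the rows (A6), the corank zeros, (G-A) / (G-B) over the
spanning-trace rank-6 flats (night-4, gen 24)

The third level of the `(10, 8)` profile LP (night-4 g20's `HB6` block, g23's exact census: the type-7 tail `d ≥ 27`
and the cases `(6, 17)`, `(6, 21)` are LP-positive with it) uses the atoms `h6_s = hypTr M G 6 s` (the rank-6 flats
with a spanning `s`-point trace) and `SP6_{s,j} = spSum M G 6 s j`.  Its rows in the tree's vocabulary: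
(A6_j) `a6_row` — the `j`-subsets of rank `q`, `q − 1`, `q − 2` are disjoint classes of the `j`-subsets
(`choose_eq_sum_card_rank_subsets`); (H3_6) `spSum_le_choose_mul_hypTr` and (H4_6) `h4_row` at `r = 6` (generic);
(H1_6) `h1_row_pairs` (`GenQColoopPairsRow`); the flat-lattice rows (G-A) / (G-B) with the spanning-trace counts
`hypTr M G 6 s` in place of `NR M G 6 s` (`ga_eq_row_eight_h6`, `gb_row_eight_h6`: the two counts agree beyond the
rank-5 flat bound `21`, `NR_eq_hypTr_of_flat_le`; (G-B) holds with the spanning traces at every rank, `gb_row`); and the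
corank zeros `hypTr_eq_zero_of_lt_corank` / `spSum_eq_zero_of_lt_corank` (a rank-`r` flat's trace misses `≥ q − r`
points of `G`).  Imports `GenQFlatLatticeA`, `GenQFlatLatticeT`.
-/
namespace PercRepro.Night4

open Finset ThmH SixFour GenQ PerFlat Star

variable {α : Type*} [DecidableEq α] {M : Matroid α} [M.Finite]

/-! ## (A6): three rank classes of the `j`-subsets -/

/-- **(A6) as an LP row**: `Σ_m #Pc (n − j) m + Σ_s SP_{s,j}^{(q−1)} + Σ_s SP_{s,j}^{(q−2)} ≤ C(n, j)` (`2 ≤ q`,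
`j ≤ n`): the `j`-subsets of rank `q`, `q − 1` and `q − 2` are disjoint classes of the `j`-subsets of `G`. -/
theorem a6_row {G : Finset α} {q : ℕ} (hG : G ⊆ gr M) (hrG : M.eRk (G : Set α) = (q : ℕ∞)) (hq : 2 ≤ q)
    {j : ℕ} (hj : j ≤ G.card) :
    ∑ m ∈ Finset.Icc (mTr M G) q, (Pc M G q (G.card - j) m).card
      + ∑ s ∈ Finset.range (G.card + 1), spSum M G (q - 1) s j
      + ∑ s ∈ Finset.range (G.card + 1), spSum M G (q - 2) s j ≤ G.card.choose j := by
  classical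
  rw [← card_rank_q_subsets_eq_sum_Pc hG hrG hj, ← h2_row hG (q - 1) j, ← h2_row hG (q - 2) j,
    choose_eq_sum_card_rank_subsets hrG j]
  have hsub : ({q, q - 1, q - 2} : Finset ℕ) ⊆ Finset.range (q + 1) := by
    intro x hx
    simp only [Finset.mem_insert, Finset.mem_singleton] at hx
    rw [Finset.mem_range]
    omega
  have h := Finset.sum_le_sum_of_subset (f := fun ρ : ℕ =>
    ((G.powersetCard j).filter (fun T : Finset α => M.eRk (T : Set α) = (ρ : ℕ∞))).card) hsub
  rw [Finset.sum_insert (by simp only [Finset.mem_insert, Finset.mem_singleton]; omega),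
    Finset.sum_insert (by simp only [Finset.mem_singleton]; omega), Finset.sum_singleton] at h
  simpa only [add_assoc] using h

/-- **(A6) below the rank** (`j < q`, no rank-`q` class): `Σ_s SP_{s,j}^{(q−1)} + Σ_s SP_{s,j}^{(q−2)} ≤ C(n, j)`. -/
theorem a6_row_low {G : Finset α} {q : ℕ} (hG : G ⊆ gr M) (hrG : M.eRk (G : Set α) = (q : ℕ∞)) (hq : 2 ≤ q)
    (j : ℕ) :
    ∑ s ∈ Finset.range (G.card + 1), spSum M G (q - 1) s j
      + ∑ s ∈ Finset.range (G.card + 1), spSum M G (q - 2) s j ≤ G.card.choose j := by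
  classical
  rw [← h2_row hG (q - 1) j, ← h2_row hG (q - 2) j, choose_eq_sum_card_rank_subsets hrG j]
  have hsub : ({q - 1, q - 2} : Finset ℕ) ⊆ Finset.range (q + 1) := by
    intro x hx
    simp only [Finset.mem_insert, Finset.mem_singleton] at hx
    rw [Finset.mem_range]
    omega
  have h := Finset.sum_le_sum_of_subset (f := fun ρ : ℕ =>
    ((G.powersetCard j).filter (fun T : Finset α => M.eRk (T : Set α) = (ρ : ℕ∞))).card) hsub
  rw [Finset.sum_insert (by simp only [Finset.mem_singleton]; omega), Finset.sum_singleton] at h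
  exact h

/-! ## The corank zeros -/

/-- A rank-`r` flat's trace misses at least `q − r` points of `G`: no rank-`r` flat has an `s`-point trace when
`n + r < s + q`. -/
theorem flatsTr_eq_empty_of_lt_corank {G : Finset α} {q r s : ℕ}
    (hrG : M.eRk (G : Set α) = (q : ℕ∞)) (h : G.card + r < s + q) : flatsTr M G r s = ∅ := by
  classical
  unfold flatsTr
  rw [Finset.filter_eq_empty_iff]
  rintro H hH ⟨hs, _⟩
  have h1 : M.eRk (G : Set α) ≤ M.eRk ((H ∩ G : Finset α) : Set α) + M.eRk ((G \ H : Finset α) : Set α) := by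
    have hU : ((G : Finset α) : Set α) = ((H ∩ G : Finset α) : Set α) ∪ ((G \ H : Finset α) : Set α) := by
      rw [← Finset.coe_union]
      congr 1
      ext x
      simp only [Finset.mem_union, Finset.mem_inter, Finset.mem_sdiff]
      tauto
    rw [hU]
    exact M.eRk_union_le_eRk_add_eRk _ _
  have h2 := eRk_inter_le_of_flatsQ (G := G) hH
  have h3 := M.eRk_le_encard ((G \ H : Finset α) : Set α)
  rw [Set.encard_coe_eq_coe_finsetCard, card_sdiff_eq_card_sub_card_inter, hs] at h3
  rw [hrG] at h1
  have h4 : (q : ℕ∞) ≤ (r : ℕ∞) + ((G.card - s : ℕ) : ℕ∞) := h1.trans (add_le_add h2 h3)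
  have h5 : q ≤ r + (G.card - s) := by exact_mod_cast h4
  have hsG : s ≤ G.card := hs ▸ Finset.card_le_card Finset.inter_subset_right
  omega

/-- `h_s^{(r)} = 0` when `n + r < s + q`. -/
theorem hypTr_eq_zero_of_lt_corank {G : Finset α} {q r s : ℕ}
    (hrG : M.eRk (G : Set α) = (q : ℕ∞)) (h : G.card + r < s + q) : hypTr M G r s = 0 := by
  unfold hypTr; rw [flatsTr_eq_empty_of_lt_corank hrG h]; rfl

/-- `SP_{s,j}^{(r)} = 0` when `n + r < s + q`. -/
theorem spSum_eq_zero_of_lt_corank {G : Finset α} {q r s : ℕ}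
    (hrG : M.eRk (G : Set α) = (q : ℕ∞)) (h : G.card + r < s + q) (j : ℕ) : spSum M G r s j = 0 := by
  unfold spSum; rw [flatsTr_eq_empty_of_lt_corank hrG h]; rfl

/-! ## The two rank-6 counts agree beyond the rank-5 flat bound -/

/-- Beyond the flat bound of the ranks below `r` (every flat of rank `< r` has `≤ B` points), every rank-`r` flat
with an `s`-point trace (`B < s`) has a SPANNING trace: `NR r s = h_s^{(r)}`. -/
theorem NR_eq_hypTr_of_flat_le {G : Finset α} {r B s : ℕ} (hG : G ⊆ gr M)
    (hB : ∀ a < r, ∀ K ∈ flatsQ M a, K.card ≤ B) (hBs : B < s) : NR M G r s = hypTr M G r s := by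
  classical
  unfold NR hypTr flatsTr
  congr 1
  refine Finset.filter_congr (fun F hF => ?_)
  refine ⟨fun hs => ⟨hs, ?_⟩, fun h => h.1⟩
  have hle := eRk_inter_le_of_flatsQ (G := G) hF
  obtain ⟨a, ha⟩ := exists_eRk_eq_nat' (M := M) (F ∩ G)
  rw [ha] at hle ⊢
  have har : a ≤ r := by exact_mod_cast hle
  by_contra hne
  have hlt : a < r := by
    have : a ≠ r := fun h => hne (by rw [h])
    omega
  have hFG : ((F ∩ G : Finset α) : Set α) ⊆ M.E := by
    rw [← coe_gr M]
    exact Finset.coe_subset.2 (Finset.inter_subset_right.trans hG)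
  have hK : clF M (F ∩ G) ∈ flatsQ M a := by
    rw [mem_flatsQ, ← Finset.coe_subset, coe_clF, coe_gr]
    exact ⟨M.closure_subset_ground _, M.isFlat_closure _, by rw [M.eRk_closure_eq, ha]⟩
  have hcard := hB a hlt _ hK
  have hsub : F ∩ G ⊆ clF M (F ∩ G) := by
    rw [← Finset.coe_subset, coe_clF]
    exact M.subset_closure _ hFG
  have := Finset.card_le_card hsub
  omega

/-- **(G-A) at `q = 8` over the spanning-trace rank-6 flats** (`22 ≤ j ≤ n`): `ga_eq_row_eight` with
`hypTr M G 6 s` in place of `NR M G 6 s`. -/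
theorem ga_eq_row_eight_h6 (hs : Simple M) (hline : ∀ L ∈ flatsQ M 2, L.card ≤ 3)
    (hplane : ∀ P ∈ flatsQ M 3, P.card ≤ 6) (hsolid : ∀ F ∈ flatsQ M 4, F.card ≤ 10)
    (hflat5 : ∀ F ∈ flatsQ M 5, F.card ≤ 21)
    {G : Finset α} (hG : G ⊆ gr M) (hrG : M.eRk (G : Set α) = ((8 : ℕ) : ℕ∞)) {j : ℕ} (h22 : 22 ≤ j)
    (hj : j ≤ G.card) :
    G.card.choose j = ∑ m ∈ Finset.Icc (mTr M G) 8, (Pc M G 8 (G.card - j) m).card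
      + ∑ s ∈ Finset.range (G.card + 1), spSum M G 7 s j
      + ∑ s ∈ Finset.range (G.card + 1), s.choose j * hypTr M G 6 s := by
  rw [ga_eq_row_eight hs hline hplane hsolid hflat5 hG hrG h22 hj]
  congr 1
  refine Finset.sum_congr rfl (fun s _ => ?_)
  rcases Nat.lt_or_ge s 22 with hlt | hge
  · rw [Nat.choose_eq_zero_of_lt (by omega : s < j), zero_mul, zero_mul]
  · rw [NR_eq_hypTr_of_flat_le (r := 6) (B := 21) hG
      (fun a ha K hK => flats_le_five_card_le_twentyone hs hline hplane hsolid hflat5 a (by omega) K hK) (by omega)]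

/-- **(G-B) at `q = 8` over the spanning-trace rank-6 flats** (`2 ≤ j`, simple `M`): `gb_row_eight` with
`hypTr M G 6 s` in place of `NR M G 6 s` (the `j`-subsets of a hyperplane trace of rank `≤ 6` lie in the closure of
themselves — a flat with a spanning trace, `gb_row`). -/
theorem gb_row_eight_h6 (hs : Simple M) {G : Finset α} (hG : G ⊆ gr M) {j : ℕ} (hj : 2 ≤ j) :
    ∑ s ∈ Finset.range (G.card + 1), s.choose j * hypTr M G 7 s
      ≤ ∑ s ∈ Finset.range (G.card + 1), spSum M G 7 s j
        + ∑ s ∈ Finset.range (G.card + 1), (G.card - s).choose 5 * (s.choose j * Nl M G s)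
        + ∑ s ∈ Finset.range (G.card + 1), (G.card - s).choose 4 * (s.choose j * NR M G 3 s)
        + ∑ s ∈ Finset.range (G.card + 1), (G.card - s).choose 3 * (s.choose j * N4 M G s)
        + ∑ s ∈ Finset.range (G.card + 1), (G.card - s).choose 2 * (s.choose j * NR M G 5 s)
        + ∑ s ∈ Finset.range (G.card + 1), (G.card - s).choose 1 * (s.choose j * hypTr M G 6 s) := by
  have h := gb_row (M := M) (q := 8) hG (by norm_num) j
  have e7 : Finset.range (8 - 1) = {0, 1, 2, 3, 4, 5, 6} := by decide
  rw [e7, Finset.sum_insert (by decide), Finset.sum_insert (by decide), Finset.sum_insert (by decide),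
    Finset.sum_insert (by decide), Finset.sum_insert (by decide), Finset.sum_insert (by decide),
    Finset.sum_singleton] at h
  simp only [Nat.reduceSub] at h
  refine h.trans ?_
  have h0 : ∀ ρ, ρ ≤ 1 → ∑ s ∈ Finset.range (G.card + 1),
      (G.card - s).choose (7 - ρ) * (s.choose j * hypTr M G ρ s) = 0 := by
    intro ρ hρ
    refine Finset.sum_eq_zero (fun s _ => ?_)
    rcases Nat.lt_or_ge s 2 with hlt | hge
    · rw [Nat.choose_eq_zero_of_lt (by omega : s < j), zero_mul, mul_zero]
    · rw [hypTr_eq_zero_of_le_one hs G hρ hge, mul_zero, mul_zero]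
  have h2 : ∑ s ∈ Finset.range (G.card + 1), (G.card - s).choose 5 * (s.choose j * hypTr M G 2 s)
      ≤ ∑ s ∈ Finset.range (G.card + 1), (G.card - s).choose 5 * (s.choose j * Nl M G s) :=
    Finset.sum_le_sum (fun s _ => Nat.mul_le_mul_left _ (Nat.mul_le_mul_left _
      ((hypTr_le_NR G 2 s).trans (le_of_eq (NR_two_eq_Nl G s)))))
  have h3 : ∑ s ∈ Finset.range (G.card + 1), (G.card - s).choose 4 * (s.choose j * hypTr M G 3 s)
      ≤ ∑ s ∈ Finset.range (G.card + 1), (G.card - s).choose 4 * (s.choose j * NR M G 3 s) :=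
    Finset.sum_le_sum (fun s _ => Nat.mul_le_mul_left _ (Nat.mul_le_mul_left _ (hypTr_le_NR G 3 s)))
  have h4 : ∑ s ∈ Finset.range (G.card + 1), (G.card - s).choose 3 * (s.choose j * hypTr M G 4 s)
      ≤ ∑ s ∈ Finset.range (G.card + 1), (G.card - s).choose 3 * (s.choose j * N4 M G s) :=
    Finset.sum_le_sum (fun s _ => Nat.mul_le_mul_left _ (Nat.mul_le_mul_left _
      ((hypTr_le_NR G 4 s).trans (le_of_eq (NR_four G s)))))
  have h5 : ∑ s ∈ Finset.range (G.card + 1), (G.card - s).choose 2 * (s.choose j * hypTr M G 5 s)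
      ≤ ∑ s ∈ Finset.range (G.card + 1), (G.card - s).choose 2 * (s.choose j * NR M G 5 s) :=
    Finset.sum_le_sum (fun s _ => Nat.mul_le_mul_left _ (Nat.mul_le_mul_left _ (hypTr_le_NR G 5 s)))
  have h00 := h0 0 (by norm_num)
  have h01 := h0 1 (by norm_num)
  simp only [Nat.reduceSub] at h00 h01
  omega

end PercRepro.Night4
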